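import Mathlib
import HarnessLib
import Summits.ValiantsHypothesis.ValiantsHypothesis.Theorems.KPlusLogSqLawWeakLiftingTowerGraftWronskianDevelopable
import Summits.ValiantsHypothesis.ValiantsHypothesis.Theorems.SymmetroidPencilBasics

/-!
# Tower graft line — CONJECTURE W IS SHARP ON THE DENSE SUPPORT AT `K = 5` AND `K = 6`: `Z₊(W(u,v)) = 2K − 4` EXACTLY, in the kernel
# (two separated double clusters)

Helper file for LINE (B) `Cruxes/WeakLifting/Lines/tower_graft.lean` (crux `WeakLifting` = stmt-ValiantsHypothesis-19561), calibrating hand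
g9's CONJECTURE W «`Z₊(W(u,v)) ≤ 2K − 4`» (= the `k = 1` developable conjecture of [cite: SedykhShapiro2005] on lacunary moment arcs,
`…WronskianDevelopable`; dense chamber PROVED there: `Z₊ ≤ 2K − 4` on `dₗ = l`).  NO stub is claimed.

THE CONSTRUCTION (prose; kernel instances below).  Two separated double clusters: `u = p²`, `v = q²` with `p`, `q` real-rooted on disjoint
intervals gives `W(p², q²) = 2·p·q·W(p,q)` and `W(p,q)` has a zero in every gap of `p` and every gap of `q` (interlacing of `p′/p` and
`q′/q`), so `Z₊ = 2·deg p + 2·(deg p − 1) = 2K − 4` for `K − 1 = 2 deg p`; for even `K` add one simple root to each cluster.  The kernel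
instances (exact integer arithmetic, IVT certificates by `norm_num`, `Z₊ ≤ 2K − 4` by `card_posRoots_wronskian_dense_le`):

* `K = 5`: `u = (X−1)²(X−2)²`, `v = (X−5)²(X−6)²`; `W(u,v) = 8(X−1)(X−2)(X−5)(X−6)(2X²−14X+17) = 16X⁶ − 336X⁵ + 2744X⁴ − 10976X³ + 22344X² −
  21952X + 8160`; SIX positive zeros (`1, 2, 5, 6, (7 ± √15)/2`), certificate `+,−,+,−,+,−,+` at `1/2, 5/4, 7/4, 3, 21/4, 23/4, 7`
  (`card_posRoots_wronskian_dense_witness_five : Z₊ = 6`).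
* `K = 6`: `u = (X−1)²(X−2)²(X−3)`, `v = (X−5)²(X−6)²(X−7)`; `W(u,v) = 20X⁸ − 608X⁷ + 7744X⁶ − 53648X⁵ + 219652X⁴ − 540848X³ + 778280X² −
  596352X + 185760`; EIGHT positive zeros, certificate `+,−,+,−,+,−,+,−,+` at `1/2, 5/4, 7/4, 5/2, 4, 21/4, 23/4, 13/2, 8`
  (`card_posRoots_wronskian_dense_witness_six : Z₊ = 8`).

With `…WronskianTowerWitness` (`K = 4`: `4` on the 2-tower `(0,1,3,20)`, exactly `4` on `(0,1,3,4)`) this puts the value `2K − 4` of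
Conjecture W in the kernel as ATTAINED for `K = 4, 5, 6` — the conjectured constant cannot be lowered.  HONEST FRAMING: explicit witnesses,
calibration only; Conjecture W (the upper bound off the Descartes chambers) is NOT proved; nothing on S4/S4b/S4d/S4f/S5/S5ᴸ, TowerB,
`WeakLifting`, Conjecture B, `MatrixDescartes` (18050) or `VP ≠ VNP`.  Def-free.  Seat: prover leafhand-val-kpluslogsqlaw-1 g10,
`--supports stmt-ValiantsHypothesis-19561 --as helper`.  [folklore: IVT certificates; the separated-cluster witnesses are this work]
-/

-- `Summit.ValiantsHypothesis.ValiantsHypothesis.…` repeats a component by the D-0017 layout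
-- (single-conjunct summit), which the `dupNamespace` linter flags; the name is mandated.
set_option linter.dupNamespace false
set_option autoImplicit false

namespace Summit.ValiantsHypothesis.ValiantsHypothesis.Theorems.KPlusLogSqLaw.TowerGraft

open Polynomial Finset
open scoped BigOperators Polynomial
open Summit.ValiantsHypothesis.ValiantsHypothesis.Theorems.SymmetroidDescartes (le_card_posRoots_of_alternating)

namespace WronskianDevelopable

/-! ## §1 `K = 5`: `u = (X−1)²(X−2)²`, `v = (X−5)²(X−6)²` -/

/-- the `K = 5` dense witness `u = (X−1)²(X−2)² = 4 − 12X + 13X² − 6X³ + X⁴` in fewnomial form. [this work] -/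
theorem dense_witness_five_u_eq :
    (∑ l : Fin 5, C ((![4, -12, 13, -6, 1] : Fin 5 → ℝ) l) * (X : ℝ[X]) ^ (l : ℕ)) =
      C 4 - C 12 * X + C 13 * X ^ 2 - C 6 * X ^ 3 + X ^ 4 := by
  simp [Fin.sum_univ_five, Matrix.cons_val]
  ring

/-- the `K = 5` dense witness `v = (X−5)²(X−6)² = 900 − 660X + 181X² − 22X³ + X⁴` in fewnomial form. [this work] -/
theorem dense_witness_five_v_eq :
    (∑ l : Fin 5, C ((![900, -660, 181, -22, 1] : Fin 5 → ℝ) l) * (X : ℝ[X]) ^ (l : ℕ)) =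
      C 900 - C 660 * X + C 181 * X ^ 2 - C 22 * X ^ 3 + X ^ 4 := by
  simp [Fin.sum_univ_five, Matrix.cons_val]
  ring

/-- **closed form** `W(u,v) = 16X⁶ − 336X⁵ + 2744X⁴ − 10976X³ + 22344X² − 21952X + 8160 = 8(X−1)(X−2)(X−5)(X−6)(2X²−14X+17)`. [this work] -/
theorem wronskian_dense_witness_five_eq :
    wronskian (C 4 - C 12 * X + C 13 * X ^ 2 - C 6 * X ^ 3 + X ^ 4 : ℝ[X])
        (C 900 - C 660 * X + C 181 * X ^ 2 - C 22 * X ^ 3 + X ^ 4) =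
      C 8160 - C 21952 * X + C 22344 * X ^ 2 - C 10976 * X ^ 3 + C 2744 * X ^ 4 - C 336 * X ^ 5 + C 16 * X ^ 6 := by
  simp only [wronskian, derivative_sub, derivative_add, derivative_mul, derivative_X,
    derivative_X_pow, Nat.cast_ofNat, map_ofNat, mul_one]
  norm_num
  ring

/-- the factorisation `8(X−1)(X−2)(X−5)(X−6)(2X²−14X+17)` of the `K = 5` witness Wronskian (roots `1, 2, 5, 6, (7 ± √15)/2`). [this work] -/
theorem wronskian_dense_witness_five_factor :
    (C 8160 - C 21952 * X + C 22344 * X ^ 2 - C 10976 * X ^ 3 + C 2744 * X ^ 4 - C 336 * X ^ 5 + C 16 * X ^ 6 : ℝ[X]) =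
      C 8 * (X - C 1) * (X - C 2) * (X - C 5) * (X - C 6) * (C 2 * X ^ 2 - C 14 * X + C 17) := by
  simp only [map_ofNat, map_one]
  ring

/-- evaluation of the `K = 5` witness Wronskian. [this work] -/
theorem eval_wronskian_dense_witness_five (t : ℝ) :
    (wronskian (C 4 - C 12 * X + C 13 * X ^ 2 - C 6 * X ^ 3 + X ^ 4 : ℝ[X])
        (C 900 - C 660 * X + C 181 * X ^ 2 - C 22 * X ^ 3 + X ^ 4)).eval t =
      8160 - 21952 * t + 22344 * t ^ 2 - 10976 * t ^ 3 + 2744 * t ^ 4 - 336 * t ^ 5 + 16 * t ^ 6 := by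
  rw [wronskian_dense_witness_five_eq]
  simp [eval_add, eval_sub, eval_mul, eval_pow, eval_C, eval_X]

/-- six positive zeros: certificate `+,−,+,−,+,−,+` at `1/2 < 5/4 < 7/4 < 3 < 21/4 < 23/4 < 7`. [this work] -/
theorem six_le_card_posRoots_wronskian_dense_witness_five :
    6 ≤ ((wronskian (C 4 - C 12 * X + C 13 * X ^ 2 - C 6 * X ^ 3 + X ^ 4 : ℝ[X])
        (C 900 - C 660 * X + C 181 * X ^ 2 - C 22 * X ^ 3 + X ^ 4)).roots.toFinset.filter (fun t => 0 < t)).card := by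
  refine le_card_posRoots_of_alternating _ 6 (![1/2, 5/4, 7/4, 3, 21/4, 23/4, 7] : Fin 7 → ℝ) ?_ ?_ ?_
  · refine Fin.strictMono_iff_lt_succ.2 fun j => ?_
    fin_cases j <;> simp only [Fin.castSucc_mk, Fin.succ_mk] <;> norm_num
  · intro j; fin_cases j <;> norm_num
  · intro j
    fin_cases j <;> simp only [Fin.castSucc_mk, Fin.succ_mk, eval_wronskian_dense_witness_five] <;> norm_num

/-- ★ **`K = 5`, dense support: `Z₊(W(u,v)) = 6 = 2K − 4` exactly.** [this work] -/
theorem card_posRoots_wronskian_dense_witness_five :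
    ((wronskian (∑ l : Fin 5, C ((![4, -12, 13, -6, 1] : Fin 5 → ℝ) l) * (X : ℝ[X]) ^ (l : ℕ))
      (∑ l : Fin 5, C ((![900, -660, 181, -22, 1] : Fin 5 → ℝ) l) * (X : ℝ[X]) ^ (l : ℕ))).roots.toFinset.filter
      (fun t => 0 < t)).card = 6 := by
  refine le_antisymm ?_ ?_
  · exact (card_posRoots_wronskian_dense_le _ _).trans (by norm_num)
  · rw [dense_witness_five_u_eq, dense_witness_five_v_eq]
    exact six_le_card_posRoots_wronskian_dense_witness_five

/-! ## §2 `K = 6`: `u = (X−1)²(X−2)²(X−3)`, `v = (X−5)²(X−6)²(X−7)` -/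

/-- the `K = 6` dense witness `u = (X−1)²(X−2)²(X−3) = −12 + 40X − 51X² + 31X³ − 9X⁴ + X⁵`. [this work] -/
theorem dense_witness_six_u_eq :
    (∑ l : Fin 6, C ((![-12, 40, -51, 31, -9, 1] : Fin 6 → ℝ) l) * (X : ℝ[X]) ^ (l : ℕ)) =
      -C 12 + C 40 * X - C 51 * X ^ 2 + C 31 * X ^ 3 - C 9 * X ^ 4 + X ^ 5 := by
  simp [Fin.sum_univ_six, Matrix.cons_val]
  ring

/-- the `K = 6` dense witness `v = (X−5)²(X−6)²(X−7) = −6300 + 5520X − 1927X² + 335X³ − 29X⁴ + X⁵`. [this work] -/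
theorem dense_witness_six_v_eq :
    (∑ l : Fin 6, C ((![-6300, 5520, -1927, 335, -29, 1] : Fin 6 → ℝ) l) * (X : ℝ[X]) ^ (l : ℕ)) =
      -C 6300 + C 5520 * X - C 1927 * X ^ 2 + C 335 * X ^ 3 - C 29 * X ^ 4 + X ^ 5 := by
  simp [Fin.sum_univ_six, Matrix.cons_val]
  ring

/-- **closed form** of the `K = 6` witness Wronskian (degree `8 = 2K − 4`). [this work] -/
theorem wronskian_dense_witness_six_eq :
    wronskian (-C 12 + C 40 * X - C 51 * X ^ 2 + C 31 * X ^ 3 - C 9 * X ^ 4 + X ^ 5 : ℝ[X])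
        (-C 6300 + C 5520 * X - C 1927 * X ^ 2 + C 335 * X ^ 3 - C 29 * X ^ 4 + X ^ 5) =
      C 185760 - C 596352 * X + C 778280 * X ^ 2 - C 540848 * X ^ 3 + C 219652 * X ^ 4 - C 53648 * X ^ 5 +
        C 7744 * X ^ 6 - C 608 * X ^ 7 + C 20 * X ^ 8 := by
  simp only [wronskian, derivative_sub, derivative_add, derivative_neg, derivative_mul, derivative_X,
    derivative_X_pow, Nat.cast_ofNat, map_ofNat, mul_one]
  norm_num
  ring

/-- evaluation of the `K = 6` witness Wronskian. [this work] -/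
theorem eval_wronskian_dense_witness_six (t : ℝ) :
    (wronskian (-C 12 + C 40 * X - C 51 * X ^ 2 + C 31 * X ^ 3 - C 9 * X ^ 4 + X ^ 5 : ℝ[X])
        (-C 6300 + C 5520 * X - C 1927 * X ^ 2 + C 335 * X ^ 3 - C 29 * X ^ 4 + X ^ 5)).eval t =
      185760 - 596352 * t + 778280 * t ^ 2 - 540848 * t ^ 3 + 219652 * t ^ 4 - 53648 * t ^ 5 +
        7744 * t ^ 6 - 608 * t ^ 7 + 20 * t ^ 8 := by
  rw [wronskian_dense_witness_six_eq]
  simp [eval_add, eval_sub, eval_mul, eval_pow, eval_C, eval_X]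

/-- eight positive zeros: certificate `+,−,+,−,+,−,+,−,+` at `1/2 < 5/4 < 7/4 < 5/2 < 4 < 21/4 < 23/4 < 13/2 < 8`. [this work] -/
theorem eight_le_card_posRoots_wronskian_dense_witness_six :
    8 ≤ ((wronskian (-C 12 + C 40 * X - C 51 * X ^ 2 + C 31 * X ^ 3 - C 9 * X ^ 4 + X ^ 5 : ℝ[X])
        (-C 6300 + C 5520 * X - C 1927 * X ^ 2 + C 335 * X ^ 3 - C 29 * X ^ 4 + X ^ 5)).roots.toFinset.filter
        (fun t => 0 < t)).card := by
  refine le_card_posRoots_of_alternating _ 8 (![1/2, 5/4, 7/4, 5/2, 4, 21/4, 23/4, 13/2, 8] : Fin 9 → ℝ) ?_ ?_ ?_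
  · refine Fin.strictMono_iff_lt_succ.2 fun j => ?_
    fin_cases j <;> simp only [Fin.castSucc_mk, Fin.succ_mk] <;> norm_num
  · intro j; fin_cases j <;> norm_num
  · intro j
    fin_cases j <;> simp only [Fin.castSucc_mk, Fin.succ_mk, eval_wronskian_dense_witness_six] <;> norm_num

/-- ★ **`K = 6`, dense support: `Z₊(W(u,v)) = 8 = 2K − 4` exactly.** [this work] -/
theorem card_posRoots_wronskian_dense_witness_six :
    ((wronskian (∑ l : Fin 6, C ((![-12, 40, -51, 31, -9, 1] : Fin 6 → ℝ) l) * (X : ℝ[X]) ^ (l : ℕ))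
      (∑ l : Fin 6, C ((![-6300, 5520, -1927, 335, -29, 1] : Fin 6 → ℝ) l) * (X : ℝ[X]) ^ (l : ℕ))).roots.toFinset.filter
      (fun t => 0 < t)).card = 8 := by
  refine le_antisymm ?_ ?_
  · exact (card_posRoots_wronskian_dense_le _ _).trans (by norm_num)
  · rw [dense_witness_six_u_eq, dense_witness_six_v_eq]
    exact eight_le_card_posRoots_wronskian_dense_witness_six

end WronskianDevelopable

end Summit.ValiantsHypothesis.ValiantsHypothesis.Theorems.KPlusLogSqLaw.TowerGraft
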